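import Mathlib
import Summits.CriticalPhenomena.CardyFormulaZ2.Theorems.CardyMagicRigidityNestingRigidityFusionCloudLoopSide
import Summits.CriticalPhenomena.CardyFormulaZ2.Theorems.CardyMagicRigidityNestingRigidityFusionBaseCases
import HarnessLib

/-!
# Crux `NestingRigidity`, line `ring-cloud-tomography` (r4): the fusion cloud on the loop side, II —
# WHICH loops carry the non-pattern factor: exactly those touching a carrier boundary (stub R5')

Crux `Summit.CriticalPhenomena.CardyFormulaZ2.Theses.CardyMagicRigidity.NestingRigidity`
(stmt-CriticalPhenomena-4835), line `ring-cloud-tomography`, skeleton r4, stub R5' `stub_fusionTilt`.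
Sequel to `…FusionCloudLoopSide` (p119417): there the loop functional of the FUSION CLOUD
`Cloud.mk n 1 z r a (fun _ ↦ 0) (fun _ ↦ L) (fun _ ↦ M) (fun _ ↦ -∑ i, a i)` (discs `B̄(z i, r i)` of
charges `a i` in the hole of one ring `(0, L, M)` of charge `−Σ a i`) was factorised as
`A_𝔠(c) = (∏_{S ≠ ∅} w_S^{N_S}) · ∏ᶠ_{u ∈ c.loops ∖ Pattern} w_u`.  Here the second factor is localised
ON THE CARRIER BOUNDARIES — the deterministic half of every decoupling estimate a fusion argument needs
(what must be controlled is: loops touching a small disc = UV loops and two-arm events, and loops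
touching the ring = finitely many scale-one loops).  Proved, no cited facts, no definitions:

* §1 a loop and a closed disc (any centre): if the TRACE MISSES the disc, the disc is surrounded
  (inside the winding interior) or avoided (off interior-and-trace) — winding constancy on the disc
  (`UnbasedLoop.wind_eq_wind_of_disjoint`); if the trace MEETS it, neither (the winding number vanishes
  on the trace); so "surrounded-or-avoided ↔ untouched" (`subset_or_disjoint_iff`);
* §2 a loop and the ring: a loop leaving the window `B(0, L)` whose trace misses the closed annulus
  `L ≤ ‖w‖ ≤ M` lies outside `B̄(0, M)` (the trace is connected: `isPreconnected_range`, intermediate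
  values of `‖·‖`), hence weighs `1` against the fusion cloud;
* §3 consequently a loop that is not a pattern loop of the window and touches neither a closed disc nor
  the closed annulus weighs `1`, pattern loops touch nothing, and THE CARRIER FORM of the decomposition
  holds: `A_𝔠(c) = (∏_{S ≠ ∅} w_S^{N_S}) · ∏ᶠ_{u ∈ c.loops, trace u ∩ (⋃_i B̄(z i, r i) ∪ ring) ≠ ∅} w_u`
  (`nestingWeight_eq_touching`; on BOTH lattice ensembles at every mesh `δ > 0`: registered anchor
  `nestingWeight_fusionCloud_eq_touching_latticeEnsembles`), the touching factor being `≥ 0` under the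
  charge bounds of `FusionCloud.finprod_mem_nonneg`;
* §4 in the cone `Σ_i |a_i| ≤ π/6` every weight lies in `[w(Σ|a_i|), w(−Σ|a_i|)] ⊆ [0, 2]`
  (`w = magicWeight`; the multi-disc form of `ConeTilt.cone_nestingFactor_mem_Icc`), so the touching
  factor is sandwiched between `w(±Σ|a_i|)^{#Touch}`: `O(1)` touching loops cost `O(1)` factors.
-/

noncomputable section

open MeasureTheory Set Filter Metric
open scoped Real Topology BigOperators

namespace Summit.CriticalPhenomena.CardyFormulaZ2.Cruxes.NestingRigidity.RingCloudTomography

open Literature.Probability.RandomPlanarGeometry Literature.Probability.Percolation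
  Literature.Probability.LatticeModels
open Summit.CriticalPhenomena.CardyFormulaZ2.Cruxes.NestingRigidity.PositiveConeWeightDoubling
  (magicWeight nonemptyParts)

namespace FusionCloud

/-! ## §1 A loop and a closed disc: surrounded, avoided, or touched -/

/-- The trace of an unbased loop is preconnected (a continuous image of `[0, 1]`). -/
theorem isPreconnected_range (u : UnbasedLoop ℂ) : IsPreconnected u.range := by
  obtain ⟨ℓ, rfl⟩ := UnbasedLoop.mk_surjective u
  obtain ⟨γ, hγ⟩ := CurveClass.surjective_mk ℓ.toCurveClass
  rw [UnbasedLoop.range_mk, ← hγ, CurveClass.range_mk]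
  exact _root_.isPreconnected_range γ.continuous

/-- **Untouched discs are surrounded or avoided.** A closed disc missed by the trace lies inside the
winding interior or off interior-and-trace: the winding number is constant on it. -/
theorem subset_or_disjoint_of_disjoint_range {u : UnbasedLoop ℂ} {x : ℂ} {ρ : ℝ}
    (h : Disjoint u.range (closedBall x ρ)) :
    closedBall x ρ ⊆ {w | u.wind w ≠ 0} ∨
      Disjoint (closedBall x ρ) ({w | u.wind w ≠ 0} ∪ u.range) := by
  by_cases hex : ∃ p ∈ closedBall x ρ, u.wind p ≠ 0
  · obtain ⟨p, hp, hwp⟩ := hex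
    exact Or.inl fun w hw ↦ by rwa [mem_setOf_eq, u.wind_eq_wind_of_disjoint h hw hp]
  · push Not at hex
    exact Or.inr (Set.disjoint_left.2 fun w hw hw' ↦ hw'.elim (fun h' ↦ h' (hex w hw))
      fun h' ↦ Set.disjoint_left.1 h h' hw)

/-- **Touched discs are neither**: a closed disc met by the trace is not surrounded (the winding
number vanishes on the trace) and not avoided. -/
theorem not_subset_of_nonempty {u : UnbasedLoop ℂ} {x : ℂ} {ρ : ℝ}
    (h : (u.range ∩ closedBall x ρ).Nonempty) :
    ¬ closedBall x ρ ⊆ {w | u.wind w ≠ 0} ∧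
      ¬ Disjoint (closedBall x ρ) ({w | u.wind w ≠ 0} ∪ u.range) := by
  obtain ⟨p, hp, hpB⟩ := h
  exact ⟨fun hsub ↦ hsub hpB (unbasedLoop_wind_of_mem_range u hp),
    fun hdis ↦ Set.disjoint_left.1 hdis hpB (Or.inr hp)⟩

/-- **Surrounded-or-avoided ↔ untouched** (the disc predicate of `patternCount`, geometrically). -/
theorem subset_or_disjoint_iff {u : UnbasedLoop ℂ} {x : ℂ} {ρ : ℝ} :
    (closedBall x ρ ⊆ {w | u.wind w ≠ 0} ∨
      Disjoint (closedBall x ρ) ({w | u.wind w ≠ 0} ∪ u.range)) ↔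
        Disjoint u.range (closedBall x ρ) := by
  refine ⟨fun h ↦ Set.disjoint_iff_inter_eq_empty.2 (Set.not_nonempty_iff_eq_empty.1 fun hne ↦ ?_),
    subset_or_disjoint_of_disjoint_range⟩
  exact h.elim (not_subset_of_nonempty hne).1 (not_subset_of_nonempty hne).2

/-! ## §2 A loop and the ring -/

/-- **A loop leaving the window and missing the closed annulus lies beyond it**: if the trace is not
inside `B(0, L)` and misses `{L ≤ ‖w‖ ≤ M}` (`L ≤ M`), it misses `B̄(0, M)` — `‖·‖` takes a value `≥ L`,
hence `> M`, on the connected trace, so it takes no value `≤ M`. -/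
theorem disjoint_range_closedBall_of_not_subset {u : UnbasedLoop ℂ} {L M : ℝ} (hLM : L ≤ M)
    (hu : ¬ u.range ⊆ ball (0 : ℂ) L) (hA : Disjoint u.range {w : ℂ | L ≤ ‖w‖ ∧ ‖w‖ ≤ M}) :
    Disjoint u.range (closedBall (0 : ℂ) M) := by
  obtain ⟨p, hp, hpL⟩ := Set.not_subset.1 hu
  rw [mem_ball_zero_iff, not_lt] at hpL
  have hpM : M < ‖p‖ := lt_of_not_ge fun hle ↦ Set.disjoint_left.1 hA hp ⟨hpL, hle⟩
  refine Set.disjoint_left.2 fun q hq hqM ↦ ?_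
  rw [mem_closedBall_zero_iff] at hqM
  obtain ⟨w, hw, hwM⟩ : M ∈ (fun w : ℂ ↦ ‖w‖) '' u.range :=
    (isPreconnected_range u).intermediate_value hq hp continuous_norm.continuousOn ⟨hqM, hpM.le⟩
  exact Set.disjoint_left.1 hA hw ⟨hLM.trans_eq hwM.symm, hwM.le⟩

/-- **Pattern loops touch no carrier boundary**: a loop of the window all of whose discs are
surrounded or avoided has its trace off every closed disc and off the closed annulus. -/
theorem disjoint_range_of_pattern {n : ℕ} {z : Fin n → ℂ} {r : Fin n → ℝ} {L M : ℝ}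
    {u : UnbasedLoop ℂ} (hu : u.range ⊆ ball (0 : ℂ) L)
    (hpat : ∀ i, closedBall (z i) (r i) ⊆ {w | u.wind w ≠ 0} ∨
      Disjoint (closedBall (z i) (r i)) ({w | u.wind w ≠ 0} ∪ u.range)) :
    Disjoint u.range ((⋃ i, closedBall (z i) (r i)) ∪ {w : ℂ | L ≤ ‖w‖ ∧ ‖w‖ ≤ M}) := by
  refine Disjoint.union_right (Set.disjoint_iUnion_right.2 fun i ↦ subset_or_disjoint_iff.1 (hpat i)) ?_
  exact Set.disjoint_left.2 fun w hw hw' ↦ (mem_ball_zero_iff.1 (hu hw)).not_ge hw'.1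

/-- A finite product of factors in `[m, M']` (`0 ≤ m`) lies in `[m^{#W}, M'^{#W}]`. -/
theorem pow_le_finprod_mem_le_pow {W : Set (UnbasedLoop ℂ)} (hW : W.Finite) {f : UnbasedLoop ℂ → ℝ}
    {m M' : ℝ} (hm : 0 ≤ m) (h : ∀ u ∈ W, f u ∈ Set.Icc m M') :
    m ^ W.ncard ≤ ∏ᶠ u ∈ W, f u ∧ ∏ᶠ u ∈ W, f u ≤ M' ^ W.ncard := by
  rw [finprod_mem_eq_finite_toFinset_prod _ hW, Set.ncard_eq_toFinset_card _ hW]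
  refine ⟨?_, ?_⟩
  · rw [← Finset.prod_const]
    exact Finset.prod_le_prod (fun _ _ ↦ hm) fun u hu ↦ (h u (hW.mem_toFinset.1 hu)).1
  · rw [← Finset.prod_const]
    exact Finset.prod_le_prod (fun u hu ↦ hm.trans (h u (hW.mem_toFinset.1 hu)).1)
      fun u hu ↦ (h u (hW.mem_toFinset.1 hu)).2

/-- The touching loops meet `B̄(0, M)` (discs in the hole `‖z i‖ + r i ≤ L ≤ M`): finitely many on every
lattice configuration (`ConeTilt.finite_loops_meeting`). -/
theorem touching_subset_meeting (c : LoopConfig ℂ) {n : ℕ} {z : Fin n → ℂ} {r : Fin n → ℝ} {L M : ℝ}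
    (hzL : ∀ i, ‖z i‖ + r i ≤ L) (hLM : L ≤ M) :
    {u ∈ c.loops | (u.range ∩ ((⋃ i, closedBall (z i) (r i)) ∪
        {w : ℂ | L ≤ ‖w‖ ∧ ‖w‖ ≤ M})).Nonempty} ⊆
      {u ∈ c.loops | (u.range ∩ closedBall (0 : ℂ) M).Nonempty} := by
  rintro u ⟨hu, p, hp, hp'⟩
  refine ⟨hu, p, hp, mem_closedBall_zero_iff.2 ?_⟩
  rcases hp' with hp' | hp'
  · obtain ⟨i, hi⟩ := Set.mem_iUnion.1 hp'
    rw [mem_closedBall, dist_eq_norm] at hi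
    linarith [hzL i, norm_le_norm_add_norm_sub' p (z i)]
  · exact hp'.2

/-! ## §3 The carrier form of the pattern decomposition -/

section Fusion

variable {𝔠 : Cloud} {n : ℕ} {z : Fin n → ℂ} {r a : Fin n → ℝ} {L M : ℝ}
  (h𝔠 : 𝔠 = Cloud.mk n 1 z r a (fun _ ↦ 0) (fun _ ↦ L) (fun _ ↦ M) (fun _ ↦ -∑ i, a i))
include h𝔠

/-- **Non-pattern loops touching no carrier boundary weigh `1`.** A loop that is not a pattern loop of
the window `B(0, L)` and whose trace misses every closed disc and the closed annulus leaves the window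
(inside it, untouched discs would make it a pattern loop), hence lies beyond `B̄(0, M)`, off the support
of the mean-zero fusion density. -/
theorem nestingFactor_eq_one_of_not_pattern (hr : ∀ i, 0 < r i) (hzL : ∀ i, ‖z i‖ + r i ≤ L)
    (hL : 0 < L) (hLM : L < M) {u : UnbasedLoop ℂ}
    (hpat : ¬ (u.range ⊆ ball (0 : ℂ) L ∧ ∀ i, closedBall (z i) (r i) ⊆ {w | u.wind w ≠ 0} ∨
      Disjoint (closedBall (z i) (r i)) ({w | u.wind w ≠ 0} ∪ u.range)))
    (htouch : Disjoint u.range ((⋃ i, closedBall (z i) (r i)) ∪ {w : ℂ | L ≤ ‖w‖ ∧ ‖w‖ ≤ M})) :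
    u.nestingFactor 𝔠.density = 1 := by
  have hdiscs : ∀ i, Disjoint u.range (closedBall (z i) (r i)) := fun i ↦
    (htouch.mono_right Set.subset_union_left).mono_right
      (Set.subset_iUnion (fun i ↦ closedBall (z i) (r i)) i)
  have hwin : ¬ u.range ⊆ ball (0 : ℂ) L := fun h ↦
    hpat ⟨h, fun i ↦ subset_or_disjoint_of_disjoint_range (hdiscs i)⟩
  exact nestingFactor_eq_one_of_disjoint (fun w hw ↦ density_eq_zero h𝔠 hzL hLM.le hw)
    (integral_density h𝔠 hr hL hLM)
    (disjoint_range_closedBall_of_not_subset hLM.le hwin (htouch.mono_right Set.subset_union_right))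

/-- **THE CARRIER FORM OF THE PATTERN DECOMPOSITION.** If finitely many loops of `c` meet `B̄(0, M)`, then
`A_𝔠(c) = (∏_{S ≠ ∅} w_S^{N_S}) · ∏ᶠ_{u ∈ Touch} w_u` with `w_S = magicWeight (Σ_{i∈S} a_i)`,
`N_S = patternCount c z r L S`, and `Touch` the loops of `c` whose TRACE MEETS a closed disc `B̄(z i, r i)`
or the closed annulus `L ≤ ‖w‖ ≤ M` (every other loop is a pattern loop of the window or weighs `1`). -/
theorem nestingWeight_eq_touching (hr : ∀ i, 0 < r i) (hzL : ∀ i, ‖z i‖ + r i ≤ L) (hL : 0 < L)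
    (hLM : L < M) {c : LoopConfig ℂ}
    (hfin : {u ∈ c.loops | (u.range ∩ closedBall (0 : ℂ) M).Nonempty}.Finite) :
    c.nestingWeight 𝔠.density =
      (∏ S ∈ nonemptyParts n, magicWeight (∑ i ∈ S, a i) ^ patternCount c z r L S) *
        ∏ᶠ u ∈ {u ∈ c.loops | (u.range ∩ ((⋃ i, closedBall (z i) (r i)) ∪
            {w : ℂ | L ≤ ‖w‖ ∧ ‖w‖ ≤ M})).Nonempty}, u.nestingFactor 𝔠.density := by
  rw [nestingWeight_eq h𝔠 hr hzL hL hLM hfin]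
  congr 1
  apply finprod_mem_inter_mulSupport_eq
  ext u
  constructor
  · rintro ⟨⟨hu, hpat⟩, hne⟩
    exact ⟨⟨hu, Set.not_disjoint_iff_nonempty_inter.1 fun h ↦ hne
      (nestingFactor_eq_one_of_not_pattern h𝔠 hr hzL hL hLM (fun h' ↦ hpat ⟨hu, h'⟩) h)⟩, hne⟩
  · rintro ⟨⟨hu, htouch⟩, hne⟩
    exact ⟨⟨hu, fun hpat ↦ Set.not_disjoint_iff_nonempty_inter.2 htouch
      (disjoint_range_of_pattern hpat.2.1 hpat.2.2)⟩, hne⟩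

/-- The touching factor is `≥ 0` under the charge bounds `P ≤ π/6`, `N ≤ 5π/6` of
`FusionCloud.nestingFactor_nonneg` (so `A_𝔠 = (∏_S w_S^{N_S}) × (a non-negative functional)`). -/
theorem finprod_mem_touching_nonneg (hr : ∀ i, 0 < r i) (hL : 0 < L) (hLM : L < M)
    (hP : ∑ i, max (a i) 0 + max (-∑ i, a i) 0 ≤ π / 6)
    (hN : ∑ i, max (-a i) 0 + max (∑ i, a i) 0 ≤ 5 * π / 6) (c : LoopConfig ℂ) :
    0 ≤ ∏ᶠ u ∈ {u ∈ c.loops | (u.range ∩ ((⋃ i, closedBall (z i) (r i)) ∪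
        {w : ℂ | L ≤ ‖w‖ ∧ ‖w‖ ≤ M})).Nonempty}, u.nestingFactor 𝔠.density :=
  finprod_mem_nonneg h𝔠 hr hL hLM hP hN _

/-! ## §4 Weights in the cone `Σ_i |a_i| ≤ π/6` -/

/-- In the cone every phase is at most the total absolute charge in absolute value … -/
theorem abs_nestingPhase_le (hr : ∀ i, 0 < r i) (hL : 0 < L) (hLM : L < M) (u : UnbasedLoop ℂ) :
    |u.nestingPhase 𝔠.density| ≤ ∑ i, |a i| := by
  have h := nestingPhase_mem_Icc h𝔠 hr hL hLM u
  exact abs_le.2 ⟨by linarith [h.1, sum_max_neg_add_max_sum_le a],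
    by linarith [h.2, sum_max_add_max_neg_sum_le a]⟩

/-- … so for `Σ_i |a_i| ≤ π/6` EVERY loop weight against the fusion cloud lies in
`[w(Σ|a_i|), w(−Σ|a_i|)] ⊆ [0, 2]` (`w = magicWeight = 2cos(· + π/3)`, monotone on `[−π/6, π/6]`). -/
theorem nestingFactor_mem_Icc_of_sum_abs_le (hr : ∀ i, 0 < r i) (hL : 0 < L) (hLM : L < M)
    (ha : ∑ i, |a i| ≤ π / 6) (u : UnbasedLoop ℂ) :
    u.nestingFactor 𝔠.density ∈
      Set.Icc (magicWeight (∑ i, |a i|)) (magicWeight (-∑ i, |a i|)) := by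
  have hθ := abs_le.1 (abs_nestingPhase_le h𝔠 hr hL hLM u)
  have h0 : 0 ≤ ∑ i, |a i| := Finset.sum_nonneg fun i _ ↦ abs_nonneg _
  set θ := u.nestingPhase 𝔠.density with hθdef
  rw [UnbasedLoop.nestingFactor, ← hθdef, magicWeight, magicWeight]
  have hπ := Real.pi_pos
  refine ⟨mul_le_mul_of_nonneg_left ?_ zero_le_two, mul_le_mul_of_nonneg_left ?_ zero_le_two⟩
  · exact Real.cos_le_cos_of_nonneg_of_le_pi (by linarith) (by linarith) (by linarith)
  · exact Real.cos_le_cos_of_nonneg_of_le_pi (by linarith) (by linarith) (by linarith)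

/-- **The touching factor in the cone is two-sidedly controlled by the NUMBER of touching loops**:
`w(Σ|a_i|)^{#Touch} ≤ ∏ᶠ_{Touch} w_u ≤ w(−Σ|a_i|)^{#Touch}` whenever finitely many loops meet `B̄(0, M)`
(so `O(1)` touching loops cost `O(1)` factors, uniformly in the configuration). -/
theorem touching_finprod_mem_Icc (hr : ∀ i, 0 < r i) (hzL : ∀ i, ‖z i‖ + r i ≤ L) (hL : 0 < L)
    (hLM : L < M) (ha : ∑ i, |a i| ≤ π / 6) {c : LoopConfig ℂ}
    (hfin : {u ∈ c.loops | (u.range ∩ closedBall (0 : ℂ) M).Nonempty}.Finite) :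
    magicWeight (∑ i, |a i|) ^ {u ∈ c.loops | (u.range ∩ ((⋃ i, closedBall (z i) (r i)) ∪
        {w : ℂ | L ≤ ‖w‖ ∧ ‖w‖ ≤ M})).Nonempty}.ncard ≤
      ∏ᶠ u ∈ {u ∈ c.loops | (u.range ∩ ((⋃ i, closedBall (z i) (r i)) ∪
        {w : ℂ | L ≤ ‖w‖ ∧ ‖w‖ ≤ M})).Nonempty}, u.nestingFactor 𝔠.density ∧
    ∏ᶠ u ∈ {u ∈ c.loops | (u.range ∩ ((⋃ i, closedBall (z i) (r i)) ∪
        {w : ℂ | L ≤ ‖w‖ ∧ ‖w‖ ≤ M})).Nonempty}, u.nestingFactor 𝔠.density ≤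
      magicWeight (-∑ i, |a i|) ^ {u ∈ c.loops | (u.range ∩ ((⋃ i, closedBall (z i) (r i)) ∪
        {w : ℂ | L ≤ ‖w‖ ∧ ‖w‖ ≤ M})).Nonempty}.ncard :=
  pow_le_finprod_mem_le_pow (hfin.subset (touching_subset_meeting c hzL hLM.le))
    (Staircase.magicWeight_nonneg_of_mem_Icc ⟨by
      linarith [Real.pi_pos, Finset.sum_nonneg fun i (_ : i ∈ Finset.univ) ↦ abs_nonneg (a i)], ha⟩)
    fun u _ ↦ nestingFactor_mem_Icc_of_sum_abs_le h𝔠 hr hL hLM ha u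

end Fusion

end FusionCloud

/-- **Carrier form of the pattern decomposition on BOTH lattice ensembles** (registered helper toward
stub R5' `stub_fusionTilt`, line `ring-cloud-tomography` r4): for `E ∈ latticeEnsembles`, mesh `δ > 0`,
sample `ω`, discs `B̄(z i, r i)` of charges `a i` in the hole of the ring `(0, L, M)` of charge `−Σ a i`
(`0 < r i`, `‖z i‖ + r i ≤ L`, `0 < L < M`), the loop functional of the fusion cloud is EXACTLY
`(∏_{S ≠ ∅} magicWeight(Σ_{i∈S} a_i)^{patternCount · z r L S})` times the product of the weights of the
loops whose trace meets a closed disc `B̄(z i, r i)` or the closed annulus `L ≤ ‖w‖ ≤ M`. -/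
theorem nestingWeight_fusionCloud_eq_touching_latticeEnsembles : ∀ E ∈ latticeEnsembles, ∀ {δ : ℝ},
    0 < δ → ∀ (ω : E.Ω) {n : ℕ} (z : Fin n → ℂ) (r a : Fin n → ℝ) {L M : ℝ}, (∀ i, 0 < r i) →
    (∀ i, ‖z i‖ + r i ≤ L) → 0 < L → L < M →
    (E.X δ ω).nestingWeight (Cloud.mk n 1 z r a (fun _ ↦ 0) (fun _ ↦ L) (fun _ ↦ M)
      (fun _ ↦ -∑ i, a i)).density =
      (∏ S ∈ nonemptyParts n, magicWeight (∑ i ∈ S, a i) ^ patternCount (E.X δ ω) z r L S) *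
        ∏ᶠ u ∈ {u ∈ (E.X δ ω).loops | (u.range ∩ ((⋃ i, Metric.closedBall (z i) (r i)) ∪
            {w : ℂ | L ≤ ‖w‖ ∧ ‖w‖ ≤ M})).Nonempty},
          u.nestingFactor (Cloud.mk n 1 z r a (fun _ ↦ 0) (fun _ ↦ L) (fun _ ↦ M)
            (fun _ ↦ -∑ i, a i)).density :=
  fun E hE _ hδ ω _ _ _ _ _ M hr hzL hL hLM ↦
    FusionCloud.nestingWeight_eq_touching rfl hr hzL hL hLM (ConeTilt.finite_loops_meeting E hE hδ ω M)

end Summit.CriticalPhenomena.CardyFormulaZ2.Cruxes.NestingRigidity.RingCloudTomography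

end
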